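import Literature.AlgebraicGeometry.HodgeTheory.HardLefschetzNFoldHolds
import Literature.AlgebraicGeometry.HodgeTheory.MotivatedClassesAlgebraic
import HarnessLib

/-!
# Every smooth projective complex variety carries a polarisation class

Family `hodge`, layer `Literature/AlgebraicGeometry/HodgeTheory`. A **polarisation class** of a
smooth projective complex `n`-fold `X` (Y. André, *Pour une théorie inconditionnelle des motifs*,
Publ. Math. IHÉS 83 (1996), §1.1 p. 10: «la classe `η = c₁(𝓛_X) ∈ H²(X)` d'un faisceau inversible
ample») is rendered in the tree by its three properties `IsPolarizationClass n X η`
(`HodgeTheory/MotivatedClasses.lean`: `η` rational, supported on a divisor, hard Lefschetz in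
dimension `n`). The tree's hard Lefschetz datum of the hyperplane class of a projective embedding,
`HardLefschetzNFold n X`, exists for every smooth projective `X` by the THEOREM
`nonempty_hardLefschetzNFold_holds` (C. Voisin, *Hodge Theory and Complex Algebraic Geometry I*,
Thm. 6.25, Rem. 6.27, §7.1.2; "Relies on: nothing unproved"), and its hyperplane class is a
polarisation class (`HardLefschetzNFold.isPolarizationClass`). Hence:

* `exists_isPolarizationClass` — for `X` smooth projective of dimension `n` over `ℂ` there is
  `η ∈ H²(X(ℂ); ℂ)` with `IsPolarizationClass n X η`.

This is the Literature-side form, statement verbatim, of the Summit-side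
`exists_isPolarizationClass_of_isSmoothProjective`
(`Summits/HodgeConjecture/HodgeConjecture/Theorems/Ring2HypothesesDescentMotivatedOnePolarisation.lean`),
landed here so that Literature files of Layer B (lane `lit-hodgefound`, DAG-B v2 §8 item 5, the
former validation row V-B5′ of TRIBUNAL-B) can cite the discharge by name. Theorems only; no
definition, no named fact (D-0026).

## References

* [VoisinHodgeI2002] C. Voisin, Hodge Theory and Complex Algebraic Geometry I (CUP 2002),
  Thm. 6.25, Rem. 6.27, §7.1.2.
* [Andre1996Motifs] Y. André, Publ. Math. IHÉS 83 (1996), §1.1 (p. 10).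
-/

noncomputable section

namespace Literature.AlgebraicGeometry.HodgeTheory

variable {n : ℕ} {X : Motives.SchemeOver ℂ}

/-- **Every smooth projective complex variety carries a polarisation class**: for `X` smooth
projective of dimension `n` over `ℂ` there is `η ∈ H²(X(ℂ); ℂ)` with `IsPolarizationClass n X η` —
the hyperplane class of the tree's hard Lefschetz datum (`nonempty_hardLefschetzNFold_holds`: a
non-zero rational multiple of `[H]` for a projective embedding, Voisin I Thm. 6.25, Rem. 6.27,
§7.1.2), which is rational, supported on the divisor `H` and satisfies hard Lefschetz
(`HardLefschetzNFold.isPolarizationClass`). [cite: VoisinHodgeI2002, Thm. 6.25, Rem. 6.27 and §7.1.2] [cite: Andre1996Motifs, §1.1 (p. 10)] -/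
theorem exists_isPolarizationClass (hX : Motives.IsSmoothProjective n X) :
    ∃ η : complexBetti X 2, IsPolarizationClass n X η := by
  obtain ⟨Λ⟩ := nonempty_hardLefschetzNFold_holds n X hX
  exact ⟨Λ.hyperplaneClass, Λ.isPolarizationClass⟩

/-- The set of polarisation classes of a smooth projective complex `n`-fold is non-empty.
[cite: VoisinHodgeI2002, Thm. 6.25, Rem. 6.27 and §7.1.2] -/
theorem setOf_isPolarizationClass_nonempty (hX : Motives.IsSmoothProjective n X) :
    {η : complexBetti X 2 | IsPolarizationClass n X η}.Nonempty :=
  exists_isPolarizationClass hX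

end Literature.AlgebraicGeometry.HodgeTheory

end
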